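import Summits.QuantumAdvantage.QuantumAdvantage.Theorems.CubicForrelationNearExactIsExactTwelveWeight768L1
import Summits.QuantumAdvantage.QuantumAdvantage.Theorems.CubicForrelationNearExactIsExactTwelveLevelFiveGe5964
import Summits.QuantumAdvantage.QuantumAdvantage.Theorems.CubicForrelationNearExactIsExactEightSymplectic
import Summits.QuantumAdvantage.QuantumAdvantage.Theorems.CubicForrelationNearExactIsExactEightTypeEEnd

/-!
# Crux `CubicForrelation.NearExactIsExact` (stmt-QuantumAdvantage-14043) — a weight-`768` cubic support on 12 bits: the rank-4 witness with an
  AFFINE TWIST (the form needed by the type-O base pattern `(−1)^{d₁}(1 − 4·1_E)`)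

Certificate seat `b2b-cforr-cert` (gen 15).  HONEST FRAMING: a coding-theory lemma (standard axioms) for the TYPE-O branch below `59/64` at
`n = 12`; NOT summit progress.

`to15_weight768_pf_twist`: for a cubic `c` of weight `768`, a transversal `w` of the hyperplane `A ⊇ {c = 1}` (`to15_weight768_hyperplane`)
and ANY affine `d`, there is a 4-flat of `A` on which the sign `(−1)^{d ⊕ c ⊕ c(·⊕w)}` has sum `≢ 0 (mod 8)`.  The twist by the character `(−1)^d = ±(−1)^{c₁·x}` only SHIFTS the
transform of `(−1)^{r'}·1_A` by `c₁`, so its `L¹` mass is unchanged (`≥ 9216 > 8192`), and `fl1_flat_l1` again forbids (H3)+(H4).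

References: Kasami–Tokura (1970); MacWilliams–Sloane (1977) Ch. 15 §2; O'Donnell (2014) §3.3.  Everything below is proved from Mathlib and
the tree; axioms are the standard three.
-/

set_option linter.dupNamespace false -- D-0017: single-problem summit ⇒ `QuantumAdvantage.QuantumAdvantage` by design

noncomputable section

namespace Summit.QuantumAdvantage.QuantumAdvantage.Theorems.CubicForrelation.NearExactIsExact

open Finset
open Literature.Computability.QuantumComplexity
open Literature.Computability.QuantumComplexity.BuzetChailloux (bxor zeroVec bxor_bxor_cancel_left bxor_zeroVec zeroVec_bxor bxor_comm
  bxor_self twist_zeroVec_right twist_bxor_right)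
open Literature.Computability.QuantumComplexity.Simon (twist_eq_one_or)
open Literature.Computability.QuantumComplexity.DerivativeWalsh (W twist_bxor_left)

/-! ### (H4) fails on the hyperplane, twisted version -/

/-- **The rank-4 witness, twisted by an affine sign.**  For a cubic `c` on 12 bits with `768` ones and any affine `d`: a hyperplane
`{(−1)^{x·z} = t} ⊇ {c = 1}`, a transversal `w`, and a 4-flat of the hyperplane on which `(−1)^{d ⊕ c ⊕ c(·⊕w)}` has sum `≢ 0 (mod 8)`.
[this work] -/
theorem to15_weight768_pf_twist (c : (Fin (6 + 6) → Bool) → Bool) (hc : IsDegLeFun 3 c)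
    (h768 : #(univ.filter fun x => c x = true) = 768) (d : (Fin (6 + 6) → Bool) → Bool) (hd : IsDegLeFun 1 d) :
    ∃ (z w : Fin (6 + 6) → Bool) (t : ℝ), z ≠ zeroVec ∧ (t = 1 ∨ t = -1) ∧ (∀ x, c x = true → twist x z = t) ∧ twist w z = -1 ∧
      ∃ (x₀ : Fin (6 + 6) → Bool) (a₀ a₁ a₂ a₃ : Fin (6 + 6) → Bool), twist x₀ z = t ∧
        twist z a₀ = 1 ∧ twist z a₁ = 1 ∧ twist z a₂ = 1 ∧ twist z a₃ = 1 ∧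
        ¬ (8 : ℤ) ∣ ∑ ε : Fin 4 → Bool, sZ (d (fun j => x₀ j ^^ decide (Odd #(univ.filter fun i =>
            ε i && (![a₀, a₁, a₂, a₃] : Fin 4 → Fin (6 + 6) → Bool) i j))) ^^
          ((c (fun j => x₀ j ^^ decide (Odd #(univ.filter fun i =>
            ε i && (![a₀, a₁, a₂, a₃] : Fin 4 → Fin (6 + 6) → Bool) i j)))) ^^
          (c (bxor (fun j => x₀ j ^^ decide (Odd #(univ.filter fun i =>
            ε i && (![a₀, a₁, a₂, a₃] : Fin 4 → Fin (6 + 6) → Bool) i j))) w)))) := by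
  classical
  obtain ⟨z, t, hz0, ht, hE⟩ := to15_weight768_in_hyperplane c hc h768
  obtain ⟨w, hw⟩ := es_exists_twist_neg hz0
  rw [twist_comm] at hw
  set S := univ.filter (fun x : Fin (6 + 6) → Bool => c x = true) with hSdef
  have hmemS : ∀ x, x ∈ S ↔ c x = true := fun x => by simp [hSdef]
  set F : (Fin (6 + 6) → Bool) → ℝ := fun y => ∑ x ∈ S, twist x y with hFdef
  have hL1 : (6144 : ℝ) ≤ ∑ y, |F y| := to15_weight768_l1 c hc h768
  -- the hyperplane `A = x₀ ⊕ V₀`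
  set A := univ.filter (fun x : Fin (6 + 6) → Bool => twist x z = t) with hAdef
  have hmemA : ∀ x, x ∈ A ↔ twist x z = t := fun x => by simp [hAdef]
  have hmemA' : ∀ x, x ∈ A ↔ twist z x = t := fun x => by rw [hmemA, twist_comm]
  set V₀ := univ.filter (fun a : Fin (6 + 6) → Bool => twist z a = 1) with hV₀def
  have hVmem : ∀ a, a ∈ V₀ ↔ twist z a = 1 := fun a => by rw [hV₀def, mem_filter]; simp
  have hV0 : zeroVec ∈ V₀ := (hVmem _).2 (twist_zeroVec_right z)
  have hVadd : ∀ x ∈ V₀, ∀ y ∈ V₀, bxor x y ∈ V₀ := by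
    intro x hx y hy; rw [hVmem] at hx hy ⊢; rw [twist_bxor_right, hx, hy, mul_one]
  have hAcard : #A = 2048 := by
    have e : A = univ.filter (fun x : Fin (6 + 6) → Bool => twist z x = t) := by ext x; rw [hmemA', mem_filter]; simp
    rw [e]; exact tw59_card_half z hz0 t ht
  obtain ⟨x₀, hx₀⟩ : A.Nonempty := card_pos.1 (by rw [hAcard]; norm_num)
  have hS_A : A = V₀.image (bxor x₀) := tw59_eq_image A V₀ z t hmemA' hVmem x₀ hx₀
  have hPV : ∀ x, x ∈ A → ∀ a ∈ V₀, bxor x a ∈ A := fun x hx a ha => fl1_coset_vadd hVadd hS_A hx ha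
  -- `E ⊆ A`, and `x ⊕ w ∉ A` for `x ∈ A`
  have hEA : ∀ x, c x = true → x ∈ A := fun x hx => (hmemA x).2 (hE x hx)
  have hout : ∀ x, x ∈ A → c (bxor x w) = false := by
    intro x hx
    by_contra h
    rw [Bool.not_eq_false] at h
    have h1 := hE _ h
    rw [twist_bxor_left, (hmemA x).1 hx, hw] at h1
    rcases ht with rfl | rfl <;> norm_num at h1
  -- the derivative `r'` and its agreement with `c` on `A`
  set r' : (Fin (6 + 6) → Bool) → Bool := fun x => c x ^^ c (bxor x w) with hr'def
  have hr' : IsDegLeFun 2 r' := stub_derivDegree (6 + 6) 2 c w hc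
  have hr'A : ∀ x, x ∈ A → r' x = c x := fun x hx => by simp only [r', hout x hx, Bool.xor_false]
  set r'' : (Fin (6 + 6) → Bool) → Bool := fun x => d x ^^ r' x with hr''def
  have hr'' : IsDegLeFun 2 r'' := bb_isDegLeFun_bxor (hd.mono (by norm_num)) hr'
  -- (H3) for `(−1)^{d ⊕ r'}`: Ax for degree 2 on 3-flats
  have H3 : ∀ x ∈ A, ∀ a b e : Fin (6 + 6) → Bool, a ∈ V₀ → b ∈ V₀ → e ∈ V₀ →
      (4 : ℤ) ∣ ∑ ε : Fin 3 → Bool, sZ (r'' (fun j => x j ^^ decide (Odd #(univ.filter fun i =>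
        ε i && (![a, b, e] : Fin 3 → Fin (6 + 6) → Bool) i j)))) := by
    intro x _ a b e _ _ _
    have h := tw15_quad_flat_sum r'' hr'' x ![a, b, e]
    rw [show (2 : ℤ) ^ ((3 + 1) / 2) = 4 by norm_num] at h
    exact h
  refine ⟨z, w, t, hz0, ht, hE, hw, ?_⟩
  by_contra hnone
  push Not at hnone
  -- (H4) for `(−1)^{d ⊕ r'}` on `A`
  have H4 : ∀ x ∈ A, ∀ a₀ a₁ a₂ a₃ : Fin (6 + 6) → Bool, a₀ ∈ V₀ → a₁ ∈ V₀ → a₂ ∈ V₀ → a₃ ∈ V₀ →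
      (8 : ℤ) ∣ ∑ ε : Fin 4 → Bool, sZ (r'' (fun j => x j ^^ decide (Odd #(univ.filter fun i =>
        ε i && (![a₀, a₁, a₂, a₃] : Fin 4 → Fin (6 + 6) → Bool) i j)))) := by
    intro x hx a₀ a₁ a₂ a₃ ha₀ ha₁ ha₂ ha₃
    exact hnone x a₀ a₁ a₂ a₃ ((hmemA x).1 hx) ((hVmem _).1 ha₀) ((hVmem _).1 ha₁) ((hVmem _).1 ha₂) ((hVmem _).1 ha₃)
  -- the engine bound `Σ_y |Â''(y)| ≤ 8192` for the twisted function
  have hpm : ∀ x ∈ A, sZ (r'' x) = 1 ∨ sZ (r'' x) = -1 := fun x _ => tp_sZ_cases _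
  have hE2 := fl1_flat_l1 V₀ A x₀ hV0 hVadd hS_A (fun x => sZ (r'' x)) hpm H3 H4
  set Af'' : (Fin (6 + 6) → Bool) → ℝ := fun x => if x ∈ A then ((sZ (r'' x) : ℤ) : ℝ) else 0 with hAf''
  have hl1'' : ∑ y, |W Af'' y| ≤ 8192 := by
    by_contra hgt
    push Not at hgt
    have hsq : (8192 : ℝ) ^ 2 < (∑ y, |W Af'' y|) ^ 2 := pow_lt_pow_left₀ hgt (by norm_num) two_ne_zero
    norm_num at hE2 hsq
    linarith
  -- untwisting: `Â''(y) = ±Â(y ⊕ c₁)`, same `L¹` mass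
  set Af : (Fin (6 + 6) → Bool) → ℝ := fun x => if x ∈ A then ((sZ (r' x) : ℤ) : ℝ) else 0 with hAf
  obtain ⟨c₁, b₁, hcb⟩ := stub_affineForm (6 + 6) d hd
  have hAf''val : ∀ x, Af'' x = signOf b₁ * twist c₁ x * Af x := by
    intro x
    simp only [Af'', Af, r'']
    split_ifs
    · rw [tee_sZ_xor]; push_cast; rw [tp_sZ_cast (d x), hcb x]
    · ring
  have hWshift : ∀ y, W Af'' y = signOf b₁ * W Af (bxor c₁ y) := by
    intro y
    unfold W
    rw [mul_sum]
    refine sum_congr rfl fun x _ => ?_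
    rw [hAf''val x, twist_bxor_right, twist_comm x c₁]; ring
  have hl1 : ∑ y, |W Af y| ≤ 8192 := by
    have e1 : ∑ y, |W Af'' y| = ∑ y, |W Af (bxor c₁ y)| := by
      refine sum_congr rfl fun y _ => ?_
      rw [hWshift y, abs_mul]
      have : |signOf b₁| = 1 := by cases b₁ <;> simp [signOf]
      rw [this, one_mul]
    have e2 : ∑ y, |W Af (bxor c₁ y)| = ∑ y, |W Af y| :=
      Fintype.sum_equiv (Equiv.mk (bxor c₁) (bxor c₁) (fun y => bxor_bxor_cancel_left c₁ y) (fun y => bxor_bxor_cancel_left c₁ y)) _ _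
        (fun y => rfl)
    rw [← e2, ← e1]; exact hl1''
  -- `Â(y) = Σ_A (−1)^{x·y} − 2F(y)`
  have hAfval : ∀ x, Af x = (if x ∈ A then (1 : ℝ) else 0) - 2 * (if x ∈ S then (1 : ℝ) else 0) := by
    intro x
    simp only [Af]
    by_cases hx : x ∈ A
    · rw [if_pos hx, if_pos hx, hr'A x hx, tp_sZ_cast]
      by_cases hcx : c x = true
      · rw [if_pos ((hmemS x).2 hcx)]; unfold signOf; rw [if_pos hcx]; norm_num
      · rw [if_neg (fun h => hcx ((hmemS x).1 h))]; unfold signOf; rw [if_neg hcx]; norm_num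
    · rw [if_neg hx, if_neg hx]
      have hxS : x ∉ S := fun h => hx (hEA x ((hmemS x).1 h))
      rw [if_neg hxS]; norm_num
  have hWAf : ∀ y, W Af y = ∑ x ∈ A, twist x y - 2 * F y := by
    intro y
    unfold W
    have e : ∀ x, Af x * twist x y = (if x ∈ A then twist x y else 0) - 2 * (if x ∈ S then twist x y else 0) := by
      intro x; rw [hAfval x]; split_ifs <;> ring
    rw [sum_congr rfl fun x _ => e x, sum_sub_distrib, ← mul_sum, ← sum_filter, ← sum_filter,
      filter_mem_eq_inter, univ_inter, filter_mem_eq_inter, univ_inter]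
  -- character sums over the hyperplane vanish off `{0, z}`
  have hcharA : ∀ y, y ≠ zeroVec → y ≠ z → ∑ x ∈ A, twist x y = 0 := by
    intro y hy0 hyz
    have e1 : ∀ x, (if x ∈ A then twist x y else 0) = (twist x y + t * twist x (bxor z y)) / 2 := by
      intro x
      rw [twist_bxor_right]
      by_cases hx : x ∈ A
      · rw [if_pos hx, (hmemA x).1 hx]; rcases ht with rfl | rfl <;> ring
      · rw [if_neg hx]
        have htx : twist x z = -t := by
          rcases twist_eq_one_or x z with h | h <;> rcases ht with rfl | rfl
          · exact absurd h (fun h' => hx ((hmemA x).2 h'))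
          · rw [h]; norm_num
          · exact h
          · exact absurd h (fun h' => hx ((hmemA x).2 h'))
        rw [htx]; rcases ht with rfl | rfl <;> ring
    have hsum : ∑ x ∈ A, twist x y = ∑ x, (if x ∈ A then twist x y else 0) := by
      rw [← sum_filter, filter_mem_eq_inter, univ_inter]
    have hzy : bxor z y ≠ (fun _ => false) := by
      intro h
      apply hyz
      have := bxor_bxor_cancel_left z y
      rw [h] at this
      rw [← this]; exact bxor_zeroVec z
    rw [hsum, sum_congr rfl fun x _ => e1 x, ← sum_div, sum_add_distrib, ← mul_sum, tz_sum_twist_left y,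
      tz_sum_twist_left (bxor z y), if_neg (show ¬ (y = fun _ => false) from hy0), if_neg hzy]
    ring
  -- `|F| ≤ 768` pointwise
  have hFle : ∀ y, |F y| ≤ 768 := by
    intro y
    have h1 : |F y| ≤ ∑ x ∈ S, |twist x y| := abs_sum_le_sum_abs _ _
    have h2 : ∑ x ∈ S, |twist x y| = 768 := by
      rw [sum_congr rfl fun x _ => by
        show |twist x y| = (1 : ℝ)
        rcases twist_eq_one_or x y with h | h <;> rw [h] <;> norm_num, sum_const, nsmul_eq_mul, h768]
      norm_num
    linarith
  -- off `{0, z}` the transform is `−2F`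
  have hrest : ∀ y, y ≠ zeroVec → y ≠ z → |W Af y| = 2 * |F y| := by
    intro y hy0 hyz
    rw [hWAf y, hcharA y hy0 hyz, zero_sub, abs_neg, abs_mul]
    norm_num
  -- split both `L¹` sums at `{0, z}`
  have hz0' : (zeroVec : Fin (6 + 6) → Bool) ≠ z := fun h => hz0 h.symm
  set T := univ.filter (fun y : Fin (6 + 6) → Bool => y ≠ zeroVec ∧ y ≠ z) with hTdef
  have hTc : univ.filter (fun y : Fin (6 + 6) → Bool => ¬ (y ≠ zeroVec ∧ y ≠ z)) = {zeroVec, z} := by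
    ext y
    simp only [mem_filter, mem_univ, true_and, not_and_or, not_not, mem_insert, mem_singleton]
  have hWsplit : ∑ y ∈ T, |W Af y| ≤ ∑ y, |W Af y| :=
    sum_le_sum_of_subset_of_nonneg (subset_univ T) fun y _ _ => abs_nonneg _
  have hWT : ∑ y ∈ T, |W Af y| = 2 * ∑ y ∈ T, |F y| := by
    rw [mul_sum]
    exact sum_congr rfl fun y hy => hrest y (mem_filter.1 hy).2.1 (mem_filter.1 hy).2.2
  have hFsplit : ∑ y, |F y| = ∑ y ∈ T, |F y| + (|F zeroVec| + |F z|) := by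
    rw [← sum_filter_add_sum_filter_not univ (fun y : Fin (6 + 6) → Bool => y ≠ zeroVec ∧ y ≠ z), hTc, sum_pair hz0']
  have hF0 := hFle zeroVec
  have hFz := hFle z
  have : (9216 : ℝ) ≤ ∑ y, |W Af y| := by linarith
  linarith

end Summit.QuantumAdvantage.QuantumAdvantage.Theorems.CubicForrelation.NearExactIsExact

end
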